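import Summits.NavierStokesRegularity.NavierStokesRegularity.Theorems.SoloSalvageWu2026ConstructCompactTools
import Summits.NavierStokesRegularity.NavierStokesRegularity.Theorems.SoloSalvageWu2026ConstructProfile
import Literature.Analysis.FunctionSpaces.WeakCompactnessLpFinite
import Literature.Analysis.FluidPDE.SereginLocalStokesIntegrabilityGain
import Literature.Analysis.FunctionSpaces.BallLipschitzDomain
import Summits.NavierStokesRegularity.NavierStokesRegularity.Theorems.SoloSalvageWu2026TangentSobolev
import HarnessLib

/-!
# C177 `Wu2026` — tools for sub-binder (E) of `Step_construct` (the Sobolev bounds (3.35) of the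
# Euler blow-down tangent on `{|y| > 1}`): a countable cover of the exterior region by admissible
# balls, a common weakly convergent subsequence for finitely many bounded `L^p` sequences, and the
# Sobolev inequality `W^{1,9/5}(B) ⊂ L^{9/2}(B)` on balls (cell `pub/ns-inputs`, seat
# `ns-in-wu-con`; route business of `GaldiLiouvilleGate`, item stmt-NavierStokesRegularity-0897)

Tools for the reduction of piece (E) of `step_construct_of_pieces` (`SoloSalvageWu2026Construct.lean`)
to a uniform local `L^{9/5}` gradient bound at good scales (p.13 l.6–83, (3.32)–(3.35)):

* `exists_centres_cover_exterior` — centres `c_k`, `|c_k| > 1`, whose balls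
  `B(c_k, (|c_k|−1)/3) ⊆ A_{|c_k| − r_k} ∩ {|y| > 1}` cover `{|y| > 1}`;
* `exists_common_subseq_weakLp` — for finitely many sequences bounded in `L^p(μ)` of a finite
  measure space, ONE subsequence along which all converge weakly (iterating the tree's
  `Literature.Analysis.FunctionSpaces.exists_subseq_tendsto_integral_mul_of_lintegral_rpow_le'`,
  Brezis Thm. 3.18);
* `lintegral_rpow_nine_halves_le_of_sobolev` — on a ball, `∫|f|^{9/2} ≤ (C(‖f‖_{9/5} + ‖Df‖_{9/5}))^{9/2}`
  for `C¹` fields (the tree's Sobolev inequality on bounded Lipschitz domains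
  `Literature.Analysis.FluidPDE.exists_eLpNorm_le_of_hasWeakFDerivOn`, `1/m − 1/3 = 1/q` with
  `m = 9/5`, `q = 9/2` — the exponent of (3.35)).

Theorems only, standard axioms, no `sorry`.

WHAT THIS IS NOT: not a proof of `Step_construct`; not a claim about NS regularity or blow-up; not
a claim about any author beyond the typed locator.
-/

set_option linter.dupNamespace false

noncomputable section

open MeasureTheory Set Filter Topology Module Metric TopologicalSpace
open scoped ENNReal NNReal Topology RealInnerProductSpace Pointwise

namespace Summit.NavierStokesRegularity.NavierStokesRegularity.Theorems.Wu2026Salvage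

open Literature.Analysis.FluidPDE Literature.Analysis.FunctionSpaces Literature.Claims.NS.Wu2026

/-! ## Admissible balls in the exterior region -/

/-- For `r = (|c| − 1)/3`, the ball `B(c, r)` lies in the annulus `A_{|c| − r}`. [folklore] -/
theorem ball_subset_annulus_of_one_lt (c : E3) :
    ball c ((‖c‖ - 1) / 3) ⊆ annulus (‖c‖ - (‖c‖ - 1) / 3) := by
  intro y hy
  rw [mem_ball, dist_eq_norm] at hy
  have h1 : ‖y‖ ≤ ‖c‖ + ‖y - c‖ := by
    calc ‖y‖ = ‖c + (y - c)‖ := by rw [add_sub_cancel]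
      _ ≤ ‖c‖ + ‖y - c‖ := norm_add_le _ _
  have h2 : ‖c‖ ≤ ‖y‖ + ‖y - c‖ := by
    calc ‖c‖ = ‖y - (y - c)‖ := by rw [sub_sub_cancel]
      _ ≤ ‖y‖ + ‖y - c‖ := norm_sub_le _ _
  refine ⟨by linarith, by linarith⟩

/-- For `|c| > 1` and `r = (|c| − 1)/3`, the CLOSED ball `B̄(c, r)` lies in `{|y| > 1}`. [folklore] -/
theorem closedBall_subset_exterior_of_one_lt {c : E3} (hc : 1 < ‖c‖) :
    closedBall c ((‖c‖ - 1) / 3) ⊆ exterior := by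
  intro y hy
  rw [mem_closedBall, dist_eq_norm] at hy
  have h2 : ‖c‖ ≤ ‖y‖ + ‖y - c‖ := by
    calc ‖c‖ = ‖y - (y - c)‖ := by rw [sub_sub_cancel]
      _ ≤ ‖y‖ + ‖y - c‖ := norm_sub_le _ _
  show 1 < ‖y‖
  linarith

/-- **A countable family of admissible balls covering `{|y| > 1}`**: centres `c_k` with `|c_k| > 1`
such that every `|y| > 1` lies in some `B(c_k, (|c_k| − 1)/3)` (density of a sequence in `ℝ³`).
[cite: Wu2026, (3.35) p.13 («on every compact subset of {|y| > 1}»)] -/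
theorem exists_centres_cover_exterior :
    ∃ c : ℕ → E3, (∀ k, 1 < ‖c k‖) ∧
      ∀ y : E3, 1 < ‖y‖ → ∃ k, y ∈ ball (c k) ((‖c k‖ - 1) / 3) := by
  obtain ⟨u, hu⟩ := TopologicalSpace.exists_dense_seq E3
  set e : E3 := EuclideanSpace.single 0 2 with he
  have he2 : ‖e‖ = 2 := by
    rw [he]
    refine (PiLp.norm_single 2 (fun _ : Fin 3 => ℝ) (0 : Fin 3) (2 : ℝ)).trans ?_
    norm_num
  refine ⟨fun k => if 1 < ‖u k‖ then u k else e, fun k => ?_, fun y hy => ?_⟩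
  · by_cases h : 1 < ‖u k‖
    · simp [h]
    · simp only [h, if_false, he2]; norm_num
  · obtain ⟨k, hk⟩ := Metric.denseRange_iff.1 hu y ((‖y‖ - 1) / 4) (by linarith)
    rw [dist_eq_norm] at hk
    have h2 : ‖y‖ ≤ ‖u k‖ + ‖y - u k‖ := by
      calc ‖y‖ = ‖u k + (y - u k)‖ := by rw [add_sub_cancel]
        _ ≤ ‖u k‖ + ‖y - u k‖ := norm_add_le _ _
    have huk : 1 < ‖u k‖ := by linarith
    refine ⟨k, ?_⟩
    simp only [huk, if_true]
    rw [mem_ball, dist_eq_norm]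
    linarith

/-! ## A common weakly convergent subsequence for finitely many bounded `L^p` sequences -/

/-- **Common weak subsequence**: finitely many sequences `f^i_n`, each bounded in `L^p(μ)` of a finite
measure space (`1 < p < ∞`), admit ONE subsequence `σ` and limits `g^i ∈ L^p` with
`∫ |g^i|^p ≤ C` and `∫ f^i_{σ n} ψ → ∫ g^i ψ` for all `ψ ∈ L^q` (iterate the tree's weak sequential
compactness `exists_subseq_tendsto_integral_mul_of_lintegral_rpow_le'` along nested subsequences).
[cite: Brezis2011, Thm. 3.18 with Thm. 4.10 and Prop. 3.5 (iii)] -/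
theorem exists_common_subseq_weakLp {ι : Type*} (S : Finset ι) {μ : Measure E3} [IsFiniteMeasure μ]
    {p q : ℝ} (hpq : p.HolderConjugate q) (f : ι → ℕ → E3 → ℝ)
    (hf : ∀ i n, AEStronglyMeasurable (f i n) μ) {C : ℝ≥0∞} (hC : C ≠ ∞)
    (hbd : ∀ i n, ∫⁻ x, ‖f i n x‖ₑ ^ p ∂μ ≤ C) :
    ∃ σ : ℕ → ℕ, StrictMono σ ∧ ∀ i ∈ S, ∃ g : E3 → ℝ, MemLp g (ENNReal.ofReal p) μ ∧
      ∫⁻ x, ‖g x‖ₑ ^ p ∂μ ≤ C ∧ ∀ ψ : E3 → ℝ, MemLp ψ (ENNReal.ofReal q) μ →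
        Tendsto (fun n => ∫ x, f i (σ n) x * ψ x ∂μ) atTop (𝓝 (∫ x, g x * ψ x ∂μ)) := by
  classical
  induction S using Finset.induction_on with
  | empty => exact ⟨id, strictMono_id, fun i hi => absurd hi (Finset.notMem_empty _)⟩
  | insert a s ha ih =>
      obtain ⟨σ, hσ, hs⟩ := ih
      obtain ⟨τ, hτ, g, hg, hgC, hw⟩ :=
        exists_subseq_tendsto_integral_mul_of_lintegral_rpow_le' hpq (f := fun n => f a (σ n))
          (fun n => hf a (σ n)) hC (fun n => hbd a (σ n))
      refine ⟨σ ∘ τ, hσ.comp hτ, fun i hi => ?_⟩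
      rcases Finset.mem_insert.1 hi with rfl | hi'
      · exact ⟨g, hg, hgC, fun ψ hψ => hw ψ hψ⟩
      · obtain ⟨g', hg', hg'C, hw'⟩ := hs i hi'
        exact ⟨g', hg', hg'C, fun ψ hψ => (hw' ψ hψ).comp hτ.tendsto_atTop⟩

/-! ## Sobolev on balls: `W^{1,9/5}(B) ⊂ L^{9/2}(B)` -/

/-- A continuous function is in every `L^p` of a ball. [folklore] -/
theorem memLp_restrict_ball_of_continuous {F : Type*} [NormedAddCommGroup F] {f : E3 → F}
    (hf : Continuous f) (c : E3) (r : ℝ) (p : ℝ≥0∞) : MemLp f p (volume.restrict (ball c r)) := by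
  haveI : IsFiniteMeasure (volume.restrict (ball c r)) :=
    isFiniteMeasure_restrict.2 measure_ball_lt_top.ne
  obtain ⟨M, hM⟩ := (isCompact_closedBall c r).exists_bound_of_continuousOn hf.continuousOn
  have htop : MemLp f ∞ (volume.restrict (ball c r)) :=
    memLp_top_of_bound hf.aestronglyMeasurable.restrict M
      (ae_restrict_of_forall_mem measurableSet_ball fun y hy => hM y (ball_subset_closedBall hy))
  exact htop.mono_exponent le_top

/-- **The Sobolev inequality of (3.35) on a ball**: there is `C = C(B)` with
`‖f‖_{L^{9/2}(B)} ≤ C (‖f‖_{L^{9/5}(B)} + ‖Df‖_{L^{9/5}(B)})` for every `C¹` field `f` — the tree's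
Gagliardo–Nirenberg–Sobolev inequality on the bounded Lipschitz domain `B` with `m = 9/5`,
`q = 9/2 = 3m/(3 − m)`. [cite: Wu2026, (3.35) p.13 l.70–83] -/
theorem exists_sobolev_nine_halves_ball (c : E3) (r : ℝ) :
    ∃ C : ℝ≥0, ∀ f : E3 → E3, ContDiff ℝ 1 f →
      eLpNorm f ((9 : ℝ≥0∞) / 2) (volume.restrict (ball c r)) ≤
        C * (eLpNorm f ((9 : ℝ≥0∞) / 5) (volume.restrict (ball c r)) +
          eLpNorm (fderiv ℝ f) ((9 : ℝ≥0∞) / 5) (volume.restrict (ball c r))) := by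
  have hd : finrank ℝ E3 = 3 := by rw [finrank_euclideanSpace, Fintype.card_fin]
  obtain ⟨C, hC⟩ := exists_eLpNorm_le_of_hasWeakFDerivOn (E := E3) (F := E3)
    (isLipschitzDomain_ball c r) isBounded_ball (by rw [hd]; norm_num)
    (m := (9 : ℝ≥0) / 5) (q := (9 : ℝ≥0) / 2)
    (by rw [le_div_iff₀ (by norm_num : (0 : ℝ≥0) < 5)]; norm_num)
    (by
      rw [div_le_div_iff₀ (by norm_num : (0 : ℝ≥0) < 5) (by norm_num : (0 : ℝ≥0) < 2)]
      norm_num)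
    (by rw [hd]; push_cast; norm_num)
  have e95 : (((9 : ℝ≥0) / 5 : ℝ≥0) : ℝ≥0∞) = (9 : ℝ≥0∞) / 5 := by
    rw [ENNReal.coe_div (by norm_num)]; norm_num
  have e92 : (((9 : ℝ≥0) / 2 : ℝ≥0) : ℝ≥0∞) = (9 : ℝ≥0∞) / 2 := by
    rw [ENNReal.coe_div (by norm_num)]; norm_num
  refine ⟨C, fun f hf => ?_⟩
  have hDfc : Continuous (fderiv ℝ f) := hf.continuous_fderiv one_ne_zero
  have key := hC f (fderiv ℝ f) (memLp_restrict_ball_of_continuous hf.continuous c r _)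
    (memLp_restrict_ball_of_continuous hDfc c r _)
    (HasWeakFDerivOn.of_contDiff_holds (⟨ball c r, isOpen_ball⟩ : Opens E3) volume hf)
  rw [e95, e92] at key
  exact key

end Summit.NavierStokesRegularity.NavierStokesRegularity.Theorems.Wu2026Salvage

end

-- WHAT THIS IS NOT: not a claim about NS regularity or blow-up; not a claim about any author beyond the typed locator.
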